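/-
Copyright (c) 2026 the pub-hodgecm-mathlib formalisation cell (harness21).  Prover seat hodgecm-mathlib-F0P3-p01 (g16) (S3-T0 co-reader); architect A-p16 (g30)
A-100 (β) (P-1 assembly second), 2026-09-01.
-/
import Literature.NumberTheory.Rogawski1990.UnitFundamentalLemmaInertFlickerAlgebra   -- ★ `flicker_theorem15`, the closed forms `phiZero ∕ phiOne ∕ phiH ∕ phiKappa`
import HarnessLib

/-!
# The three κ-sums of the P-1 assembly socket — pure arithmetic (road «S3-tree», T3′ population (1), hyperspecial depth zero)

Topic `NumberTheory/Rogawski1990`; namespace `Literature.NumberTheory.Rogawski1990.Flicker1998`.  KERNEL lane: THEOREMS ONLY (no `def`, no instance, no notation,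
no named fact, no `sorry`).  Cell `pub/hodgecm-mathlib`, crux H413 = `stmt-HodgeConjecture-24833`, `--supports` only.
HONEST LABEL: HC_CM is proved only modulo the 2 remaining named inputs (hLiu418 24832, h413 24833) until rung 0 closes; this file is arithmetic and pays no
letter by itself.

THE MATHEMATICS.  The P-1 assembly socket ★ `finsum_finExplicitDelta_mul_classOrbitalIntegral_eq_of_split_of_strata` (DepthZeroKappaTransferTypeOneSocket) consumes,
for Flicker's four matched representatives `t₁, …, t₄` of the stable class of a deep regular element of the anisotropic `E`-split torus with valuation triple
`(N₁, N₂, N)` [Flicker1998UnitaryFL, Prop. 3 p. 78, §6 p. 95], the three `κ`-SUMS of the rank-strata counts `n i r` (`κ = (+,+,−,−)`):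
* `hK`  (all strata): `Σκ n_i = (−q)^{N₁+N₂} φ_H(N)` — ★ `flicker_theorem15` on the ★ unit rows (`sum_ncard_rankStrata_eq_phiOne∕phiZero_of_congr`);
* `hK₀` (rank-0 stratum): the ★ ROW-0 closed forms `ncard_rankStratum_zero_eq_phiOne∕phiZero_of_congr` read `φ₁(Q₁−1, P−1)` ∕ `φ₀(Q₁−1, Q₂−1, P−1)`, so the
  `κ`-sum is Flicker's Theorem 15 AT THE SHIFTED TRIPLE `(N₁−1, N₂−1, N−1)` — **`flicker_theorem15_pred`** below (the trichotomy «the two smallest are equal»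
  survives the shift; `(−q)^{(N₁−1)+(N₂−1)} = (−q)^{N₁+N₂−2}` for `N₁, N₂ ≥ 1`);
* `hK₂` (rank-2 stratum): the ★ ROW-2 parity literals `ncard_rankStratum_two_eq_of_congr_one` (frame `h`, fires iff `Q₁+P` and `Q₁+Q₂` are both even) and
  `ncard_rankStratum_two_eq_of_congr` (frames `D_π h`, fires iff `Q₁+P` odd and `Q₁+Q₂` even), with the literals' exponent triples `(Q₁,Q₂,P) = (N₁,N₂,N)`,
  `(N₁,N₂,N)`, `(N,N₂,N₁)`, `(N₁,N,N₂)` (p. 95: `Φ(t₃) = φ(N,N₂,N₁)`, `Φ(t₄) = φ(N₁,N,N₂)`), give **`kappaSum_rankStratum_two`**: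
  `n₁₂ + n₂₂ − n₃₂ − n₄₂ = (−1)^{N₁+N₂}(q+1)² q^{N₁+N₂+N−2}` — in each of the four parity classes of `(N₁+N, N₁+N₂)` exactly one literal fires, with the sign
  of its `κ` (no trichotomy needed).
Numerically certified by the S3-T0 tables (co-reader DIFF #6: `R2`-row `κ`-sums `16·q^{Σ−2}`-pattern at q = 3, 5, 7).

## References
* [Flicker1998UnitaryFL] Y. Z. Flicker, *Elementary proof of the fundamental lemma for a unitary group*, Canad. J. Math. 50 (1998), 74–98: Prop. 3 p. 78, Prop. 11
  p. 87, Prop. 14 p. 94, §6 Theorem 15 pp. 95–96.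
* [Rogawski1990] J. D. Rogawski, *Automorphic Representations of Unitary Groups in Three Variables*, Ann. of Math. Stud. 123 (1990), §4.9 Prop. 4.9.1 (b) p. 55,
  Lemma 4.9.3 p. 56.
-/

namespace Literature.NumberTheory.Rogawski1990.Flicker1998

/-! ## §1 The rank-0 row: Theorem 15 at the shifted triple -/

/-- **FLICKER'S THEOREM 15 AT THE SHIFTED TRIPLE `(N₁−1, N₂−1, N−1)`** (the `κ`-sum of the ★ ROW-0 closed forms = the socket's `hK₀`): for `N₁, N₂, N ≥ 1` with the
two smallest of `N₁, N₂, N` equal, `φ₀(N₁−1,N₂−1,N−1) + φ₁(N₁−1,N−1) − φ₁(N−1,N₁−1) − φ₁(N₁−1,N₂−1) = (−q)^{N₁+N₂−2} · φ_H(N−1)`.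
[cite: Flicker1998UnitaryFL, §6 Theorem 15 pp. 95–96] -/
theorem flicker_theorem15_pred {q : ℕ} (hq : 1 < q) {N₁ N₂ N : ℕ} (h₁ : 1 ≤ N₁) (h₂ : 1 ≤ N₂) (hN : 1 ≤ N)
    (h : (N₁ = N₂ ∧ N₁ ≤ N) ∨ (N₁ = N ∧ N₁ ≤ N₂) ∨ (N₂ = N ∧ N₂ ≤ N₁)) :
    phiZero q (N₁ - 1) (N₂ - 1) (N - 1) + phiOne q (N₁ - 1) (N - 1) - phiOne q (N - 1) (N₁ - 1) - phiOne q (N₁ - 1) (N₂ - 1) =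
      (-(q : ℚ)) ^ (N₁ + N₂ - 2) * phiH q (N - 1) := by
  have h' : (N₁ - 1 = N₂ - 1 ∧ N₁ - 1 ≤ N - 1) ∨ (N₁ - 1 = N - 1 ∧ N₁ - 1 ≤ N₂ - 1) ∨ (N₂ - 1 = N - 1 ∧ N₂ - 1 ≤ N₁ - 1) := by omega
  have h15 := flicker_theorem15 hq h'
  rw [phiKappa, show N₁ - 1 + (N₂ - 1) = N₁ + N₂ - 2 by omega] at h15
  exact h15

/-- **The socket's `hK₀` literally**: with the four ROW-0 counts `n₁₀, …, n₄₀` read from ★ `ncard_rankStratum_zero_eq_phiZero_of_congr` (literal `t₁`) and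
★ `ncard_rankStratum_zero_eq_phiOne_of_congr` (literals `t₂, t₃, t₄`, exponent pairs `(Q₁,P) = (N₁,N), (N,N₁), (N₁,N₂)`),
`(n₁₀ + n₂₀) − (n₃₀ + n₄₀) = (−q)^{N₁+N₂−2} φ_H(N−1)`. [cite: Flicker1998UnitaryFL, §6 Theorem 15 pp. 95–96; Prop. 11 p. 87; Prop. 14 p. 94] -/
theorem kappaSum_rankStratum_zero {q : ℕ} (hq : 1 < q) {N₁ N₂ N : ℕ} (h₁ : 1 ≤ N₁) (h₂ : 1 ≤ N₂) (hN : 1 ≤ N)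
    (h : (N₁ = N₂ ∧ N₁ ≤ N) ∨ (N₁ = N ∧ N₁ ≤ N₂) ∨ (N₂ = N ∧ N₂ ≤ N₁)) (n₁ n₂ n₃ n₄ : ℕ)
    (hn₁ : (n₁ : ℚ) = phiZero q (N₁ - 1) (N₂ - 1) (N - 1)) (hn₂ : (n₂ : ℚ) = phiOne q (N₁ - 1) (N - 1))
    (hn₃ : (n₃ : ℚ) = phiOne q (N - 1) (N₁ - 1)) (hn₄ : (n₄ : ℚ) = phiOne q (N₁ - 1) (N₂ - 1)) :
    ((n₁ + n₂ : ℕ) : ℚ) - ((n₃ + n₄ : ℕ) : ℚ) = (-(q : ℚ)) ^ (N₁ + N₂ - 2) * phiH q (N - 1) := by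
  push_cast
  rw [hn₁, hn₂, hn₃, hn₄, ← flicker_theorem15_pred hq h₁ h₂ hN h]
  ring

/-! ## §2 The unit row: Theorem 15 itself, in the socket's shape -/

/-- **The socket's `hK` literally**: with the four TOTAL counts read from ★ `sum_ncard_rankStrata_eq_phiZero_of_congr` (literal `t₁`: `Σ_r n₁ᵣ = φ₀(N₁,N₂,N)`) and
★ `sum_ncard_rankStrata_eq_phiOne_of_congr` (literals `t₂, t₃, t₄`: `φ₁(N₁,N), φ₁(N,N₁), φ₁(N₁,N₂)`), the `κ`-sum is `(−q)^{N₁+N₂} φ_H(N)` (Theorem 15).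
[cite: Flicker1998UnitaryFL, §6 Theorem 15 pp. 95–96] -/
theorem kappaSum_rankStrata {q : ℕ} (hq : 1 < q) {N₁ N₂ N : ℕ}
    (h : (N₁ = N₂ ∧ N₁ ≤ N) ∨ (N₁ = N ∧ N₁ ≤ N₂) ∨ (N₂ = N ∧ N₂ ≤ N₁)) (s₁ s₂ s₃ s₄ : ℚ)
    (hs₁ : s₁ = phiZero q N₁ N₂ N) (hs₂ : s₂ = phiOne q N₁ N) (hs₃ : s₃ = phiOne q N N₁) (hs₄ : s₄ = phiOne q N₁ N₂) :
    s₁ + s₂ - (s₃ + s₄) = (-(q : ℚ)) ^ (N₁ + N₂) * phiH q N := by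
  rw [hs₁, hs₂, hs₃, hs₄, ← flicker_theorem15 hq h, phiKappa]
  ring

/-! ## §3 The rank-2 row: parity arithmetic -/

/-- **κ-SUM OF THE RANK-2 STRATUM (ROW-2), ALL PARITIES** (the socket's `hK₂`): with the four literal counts read from ★ `ncard_rankStratum_two_eq_of_congr_one`
(literal `t₁`, exponents `(N₁,N₂,N)`) and ★ `ncard_rankStratum_two_eq_of_congr` (literals `t₂, t₃, t₄`, exponent triples `(Q₁,Q₂,P) = (N₁,N₂,N)`, `(N,N₂,N₁)`,
`(N₁,N,N₂)`), `n₁ + n₂ − n₃ − n₄ = (−1)^{N₁+N₂}(q+1)²q^{N₁+N₂+N−2}` — no trichotomy needed: in each parity class of `(N₁+N, N₁+N₂)` exactly one literal fires,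
with the sign of its `κ`. [cite: Flicker1998UnitaryFL, Prop. 11 p. 87, Prop. 14 p. 94, §6 p. 95] [cite: Rogawski1990, §4.9 Lemma 4.9.3 p. 56] -/
theorem kappaSum_rankStratum_two (q N₁ N₂ N : ℕ) (n₁ n₂ n₃ n₄ : ℕ)
    (h₁ : (n₁ : ℚ) = if (N₁ + N) % 2 = 0 ∧ (N₁ + N₂) % 2 = 0 then (((q + 1) ^ 2 * q ^ (N₁ + N₂ + N - 2) : ℕ) : ℚ) else 0)
    (h₂ : (n₂ : ℚ) = if (N₁ + N) % 2 = 1 ∧ (N₁ + N₂) % 2 = 0 then (((q + 1) ^ 2 * q ^ (N₁ + N₂ + N - 2) : ℕ) : ℚ) else 0)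
    (h₃ : (n₃ : ℚ) = if (N + N₁) % 2 = 1 ∧ (N + N₂) % 2 = 0 then (((q + 1) ^ 2 * q ^ (N + N₂ + N₁ - 2) : ℕ) : ℚ) else 0)
    (h₄ : (n₄ : ℚ) = if (N₁ + N₂) % 2 = 1 ∧ (N₁ + N) % 2 = 0 then (((q + 1) ^ 2 * q ^ (N₁ + N + N₂ - 2) : ℕ) : ℚ) else 0) :
    ((n₁ + n₂ : ℕ) : ℚ) - ((n₃ + n₄ : ℕ) : ℚ) = (-1 : ℚ) ^ (N₁ + N₂) * ((q : ℚ) + 1) ^ 2 * (q : ℚ) ^ (N₁ + N₂ + N - 2) := by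
  have e₃ : N + N₂ + N₁ - 2 = N₁ + N₂ + N - 2 := by omega
  have e₄ : N₁ + N + N₂ - 2 = N₁ + N₂ + N - 2 := by omega
  rw [e₃] at h₃
  rw [e₄] at h₄
  push_cast at h₁ h₂ h₃ h₄ ⊢
  rw [h₁, h₂, h₃, h₄]
  rcases Nat.even_or_odd (N₁ + N₂) with hb | hb <;> rcases Nat.even_or_odd (N₁ + N) with ha | ha
  · have hc : (N + N₂) % 2 = 0 := by rcases hb with ⟨k, hk⟩; rcases ha with ⟨l, hl⟩; omega
    rw [Even.neg_one_pow hb]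
    simp [Nat.even_iff.mp hb, Nat.even_iff.mp ha, hc, show (N + N₁) % 2 = 0 by rw [Nat.add_comm]; exact Nat.even_iff.mp ha]
  · have hc : (N + N₂) % 2 = 1 := by rcases hb with ⟨k, hk⟩; rcases ha with ⟨l, hl⟩; omega
    rw [Even.neg_one_pow hb]
    simp [Nat.even_iff.mp hb, Nat.odd_iff.mp ha, hc, show (N + N₁) % 2 = 1 by rw [Nat.add_comm]; exact Nat.odd_iff.mp ha]
  · have hc : (N + N₂) % 2 = 1 := by rcases hb with ⟨k, hk⟩; rcases ha with ⟨l, hl⟩; omega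
    rw [Odd.neg_one_pow hb]
    simp [Nat.odd_iff.mp hb, Nat.even_iff.mp ha, hc, show (N + N₁) % 2 = 0 by rw [Nat.add_comm]; exact Nat.even_iff.mp ha]
  · have hc : (N + N₂) % 2 = 0 := by rcases hb with ⟨k, hk⟩; rcases ha with ⟨l, hl⟩; omega
    rw [Odd.neg_one_pow hb]
    simp [Nat.odd_iff.mp hb, Nat.odd_iff.mp ha, hc, show (N + N₁) % 2 = 1 by rw [Nat.add_comm]; exact Nat.odd_iff.mp ha]

/-- **The same in the socket's cast shape with `q = N(v)` an arbitrary natural and the sign written `(−1)^{N₁+N₂}`** — a restatement of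
`kappaSum_rankStratum_two` with the two `ℕ`-sums pre-cast (`((n₁ + n₂ : ℕ) : ℚ) − ((n₃ + n₄ : ℕ) : ℚ)`), which is literally the socket's `hK₂` left-hand side.
(Alias kept for the assembler's `exact`; no new content.) [cite: Flicker1998UnitaryFL, §6 p. 95] -/
theorem kappaSum_rankStratum_two' (q N₁ N₂ N : ℕ) (n : Fin 4 → ℕ → ℕ)
    (h₁ : (n 0 2 : ℚ) = if (N₁ + N) % 2 = 0 ∧ (N₁ + N₂) % 2 = 0 then (((q + 1) ^ 2 * q ^ (N₁ + N₂ + N - 2) : ℕ) : ℚ) else 0)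
    (h₂ : (n 1 2 : ℚ) = if (N₁ + N) % 2 = 1 ∧ (N₁ + N₂) % 2 = 0 then (((q + 1) ^ 2 * q ^ (N₁ + N₂ + N - 2) : ℕ) : ℚ) else 0)
    (h₃ : (n 2 2 : ℚ) = if (N + N₁) % 2 = 1 ∧ (N + N₂) % 2 = 0 then (((q + 1) ^ 2 * q ^ (N + N₂ + N₁ - 2) : ℕ) : ℚ) else 0)
    (h₄ : (n 3 2 : ℚ) = if (N₁ + N₂) % 2 = 1 ∧ (N₁ + N) % 2 = 0 then (((q + 1) ^ 2 * q ^ (N₁ + N + N₂ - 2) : ℕ) : ℚ) else 0) :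
    ((n 0 2 + n 1 2 : ℕ) : ℚ) - ((n 2 2 + n 3 2 : ℕ) : ℚ) = (-1 : ℚ) ^ (N₁ + N₂) * ((q : ℚ) + 1) ^ 2 * (q : ℚ) ^ (N₁ + N₂ + N - 2) :=
  kappaSum_rankStratum_two q N₁ N₂ N (n 0 2) (n 1 2) (n 2 2) (n 3 2) h₁ h₂ h₃ h₄

end Literature.NumberTheory.Rogawski1990.Flicker1998
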